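import Literature.AlgebraicGeometry.Limits.SubalgebraDiagram
import Mathlib.RingTheory.Localization.Away.Basic
import HarnessLib

/-!
# Limits of schemes: `Spec A_S` as the limit of the basic open subschemes `Spec A[1/s]`

Topic: `Literature/AlgebraicGeometry/Limits` (companion of `Limits/SubalgebraDiagram`, whose
architecture this file and its sequel `Limits/LocalizationProdLimit` copy). Let `A` be a commutative ring, `S ⊆ A` a submonoid and `B` a
localization of `A` at `S` (`IsLocalization S B`; e.g. `B = A_𝔭` for `S = A ∖ 𝔭`, or the fraction
field). Then `B = colim_{s ∈ S} A[1/s]` is a *filtered* colimit of the localizations away from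
single elements (ordered by divisibility), so `Spec B = lim_s Spec A[1/s]` is a cofiltered limit of
*open subschemes* `D(s)` of `Spec A` with affine (indeed open-immersion) transition maps, and for
every `A`-scheme `P` the fibre product `P ×_A Spec B = (P ⊗ Spec B).left` is the limit of the open
subschemes `P ×_A Spec A[1/s] = (P ⊗ Spec A[1/s]).left` of `P` — the setting of Mathlib's
`Mathlib.AlgebraicGeometry.AffineTransitionLimit` (Stacks 01YT; EGA IV₃ §8; Görtz–Wedhorn I,
(10.13)). This is the limit formalism behind every "spreading out from the local ring `A_𝔭` (or
from the generic point) to an open neighbourhood `D(s)`" argument; the consumer in this tree is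
the existence programme for Néron models (`Literature.NumberTheory.EllipticCurves.NeronModel*`:
the local criterion for the Néron property and the gluing of a local Néron model at one prime).

## Content (`namespace LocApprox`)

* `Idx S` — the elements of `S` preordered by reverse divisibility (`t ≤ s ↔ s ∣ t`, i.e.
  `D(t) ⊆ D(s)`); downward directed and nonempty, hence a cofiltered small category.
* `ringDiagram`, `ringCocone`, **`isColimitRingCocone`** — `B = colim_s A[1/s]` in `CommRingCat`
  (proved from the universal property of localizations: a compatible family `A[1/s] → C`
  inverts `S`).
* `baseDiagram`, `baseCone`, `isLimitForgetBaseCone`, `isLimitBaseCone` — `Spec B = lim Spec A[1/s]`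
  in `Scheme` and in `Over (Spec A)` (`Scheme.Spec` preserves limits; `Over.forget` reflects
  connected limits); the stages are open subschemes of `Spec A`
  (`isOpenImmersion_baseDiagram_obj_hom`, Mathlib `IsOpenImmersion.of_isLocalization`).
* The sequel `Limits/LocalizationProdLimit` deduces `(P ⊗ Spec B).left = lim_s (P ⊗ Spec A[1/s]).left`
  for every `A`-scheme `P` and the two halves of Stacks 01ZC (spreading out of morphisms) in this
  setting.

Mathlib searched (pin): `AffineTransitionLimit` (consumer API, used), `IsLocalization.Away.lift`,
`IsLocalization.Away.isUnit_of_dvd`, `IsLocalization.lift`, `isLimitConeRightOpOfCocone`,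
`Over.createsLimitsOfShapeForgetOfIsConnected` (used); Mathlib has no presentation of `Spec A_𝔭`
or `Spec (Frac A)` as a limit of basic open subschemes (grep `IsLocalization` in
`Mathlib/AlgebraicGeometry/AffineTransitionLimit.lean`, `SpreadingOut.lean`: none).

## References

* The Stacks project, Tags 01YT (limits of schemes, directed inverse systems with affine
  transition maps), 01ZC (morphisms of finite presentation and limits). [StacksProject]
* A. Grothendieck, EGA IV₃, §8.2, Prop. 8.13.1 (Publ. Math. IHÉS 28, 1966). [EGAIV3]
* U. Görtz, T. Wedhorn, *Algebraic Geometry I: Schemes*, 2nd ed. (2020), (10.13) and Thm. 10.57,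
  pp. 321–327. [GortzWedhorn2020]
-/

noncomputable section

universe u

open CategoryTheory CategoryTheory.Limits AlgebraicGeometry TopologicalSpace MonoidalCategory
open Opposite

namespace Literature.AlgebraicGeometry.Limits

namespace LocApprox

open Literature.AlgebraicGeometry.Motives (SchemeOver specOver)

set_option backward.isDefEq.respectTransparency false

variable {A : Type u} [CommRing A] (S : Submonoid A) (B : Type u) [CommRing B] [Algebra A B]
  [IsLocalization S B]

/-- The index type: elements of the submonoid `S`, preordered by *reverse divisibility*
(`t ≤ s ↔ s ∣ t`, i.e. `D(t) ⊆ D(s)`), a downward directed nonempty preorder, hence a cofiltered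
category. (A one-field structure rather than the subtype `↥S`, so as not to inherit an order
from `A`.) [folklore] -/
structure Idx : Type u where
  /-- the underlying element of `A` -/
  val : A
  /-- membership in `S` -/
  mem : val ∈ S

/-- `t ≤ s` iff `s ∣ t` (then `A[1/s] → A[1/t]` and `Spec A[1/t] → Spec A[1/s]`). [folklore] -/
instance : Preorder (Idx S) where
  le t s := s.val ∣ t.val
  le_refl _ := dvd_rfl
  le_trans _ _ _ hts hsr := dvd_trans hsr hts

variable {S} in
/-- Unfolding of `≤` on indices. [folklore] -/
theorem Idx.le_iff {t s : Idx S} : t ≤ s ↔ s.val ∣ t.val := Iff.rfl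

/-- The index `1`. [folklore] -/
instance : Inhabited (Idx S) := ⟨⟨1, S.one_mem⟩⟩

/-- The index type is nonempty. [folklore] -/
instance : Nonempty (Idx S) := ⟨default⟩

/-- The index type is directed downwards (`st` refines `s` and `t`). [folklore] -/
instance : IsDirected (Idx S) (· ≥ ·) :=
  ⟨fun s t => ⟨⟨s.val * t.val, S.mul_mem s.mem t.mem⟩, dvd_mul_right _ _, dvd_mul_left _ _⟩⟩

-- the index category is cofiltered (Mathlib `isCofiltered_of_directed_ge_nonempty`)
example : IsCofiltered (Idx S) := inferInstance

/-- Every index refines the index `1`. [folklore] -/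
theorem Idx.le_default (s : Idx S) : s ≤ default := one_dvd _

/-- The localization `A[1/s]` attached to an index. [folklore] -/
abbrev loc (s : Idx S) : Type u := Localization.Away s.val

variable {S} in
/-- For `t ≤ s` (i.e. `s ∣ t`) the canonical ring map `A[1/s] → A[1/t]`. [folklore] -/
def locMap {t s : Idx S} (h : t ≤ s) : loc S s →+* loc S t :=
  IsLocalization.Away.lift s.val
    (IsLocalization.Away.isUnit_of_dvd (S := loc S t) t.val (Idx.le_iff.mp h))

variable {S} in
/-- `locMap` is an `A`-algebra map (elementwise). [folklore] -/
@[simp]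
theorem locMap_algebraMap {t s : Idx S} (h : t ≤ s) (a : A) :
    locMap h (algebraMap A (loc S s) a) = algebraMap A (loc S t) a := by
  unfold locMap
  exact IsLocalization.Away.lift_eq _ _ _

variable {S} in
/-- `locMap` is an `A`-algebra map. [folklore] -/
theorem locMap_comp_algebraMap {t s : Idx S} (h : t ≤ s) :
    (locMap h).comp (algebraMap A (loc S s)) = algebraMap A (loc S t) := by
  unfold locMap
  exact IsLocalization.Away.lift_comp _ _

/-- The filtered diagram `s ↦ A[1/s]` (contravariant in the index preorder). [folklore] -/
def ringDiagram : (Idx S)ᵒᵖ ⥤ CommRingCat.{u} where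
  obj s := CommRingCat.of (loc S s.unop)
  map {s t} f := CommRingCat.ofHom (locMap f.unop.le)
  map_id s := by
    ext : 1
    refine IsLocalization.ringHom_ext (Submonoid.powers s.unop.val) (S := loc S s.unop) ?_
    change (locMap (𝟙 s : s ⟶ s).unop.le).comp (algebraMap A (loc S s.unop)) =
      (RingHom.id (loc S s.unop)).comp (algebraMap A (loc S s.unop))
    rw [locMap_comp_algebraMap, RingHom.id_comp]
  map_comp {s t r} f g := by
    ext : 1
    refine IsLocalization.ringHom_ext (Submonoid.powers s.unop.val) (S := loc S s.unop) ?_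
    change (locMap (f ≫ g).unop.le).comp (algebraMap A (loc S s.unop)) =
      ((locMap g.unop.le).comp (locMap f.unop.le)).comp (algebraMap A (loc S s.unop))
    rw [locMap_comp_algebraMap, RingHom.comp_assoc, locMap_comp_algebraMap,
      locMap_comp_algebraMap]

variable {S} in
/-- The objects of `ringDiagram` (by `rfl`). [folklore] -/
theorem ringDiagram_obj (s : (Idx S)ᵒᵖ) : (ringDiagram S).obj s = CommRingCat.of (loc S s.unop) :=
  rfl

variable {S} in
/-- The transition maps of `ringDiagram` (by `rfl`). [folklore] -/
theorem ringDiagram_map_hom {s t : (Idx S)ᵒᵖ} (f : s ⟶ t) :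
    ((ringDiagram S).map f).hom = locMap f.unop.le :=
  rfl

variable {S} in
/-- The transition maps of `ringDiagram` are `A`-algebra maps. [folklore] -/
theorem ringDiagram_map_comp_algebraMap {s t : (Idx S)ᵒᵖ} (f : s ⟶ t) :
    ((ringDiagram S).map f).hom.comp (algebraMap A (loc S s.unop)) =
      algebraMap A (loc S t.unop) :=
  locMap_comp_algebraMap f.unop.le

/-- The map `A[1/s] → B` for `s ∈ S` (`s` is a unit in `B = A_S`). [folklore] -/
def toLoc (s : Idx S) : loc S s →+* B :=
  IsLocalization.Away.lift s.val (IsLocalization.map_units B ⟨s.val, s.mem⟩)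

/-- `A[1/s] → B` is an `A`-algebra map. [folklore] -/
theorem toLoc_comp_algebraMap (s : Idx S) :
    (toLoc S B s).comp (algebraMap A (loc S s)) = algebraMap A B := by
  unfold toLoc
  exact IsLocalization.Away.lift_comp _ _

/-- The cocone of the maps `A[1/s] → B`. [folklore] -/
def ringCocone : Cocone (ringDiagram S) where
  pt := CommRingCat.of B
  ι := { app s := CommRingCat.ofHom (toLoc S B s.unop)
         naturality s t f := by
           ext : 1
           refine IsLocalization.ringHom_ext (Submonoid.powers s.unop.val) (S := loc S s.unop) ?_
           change ((toLoc S B t.unop).comp (locMap f.unop.le)).comp (algebraMap A (loc S s.unop)) =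
             ((RingHom.id B).comp (toLoc S B s.unop)).comp (algebraMap A (loc S s.unop))
           rw [RingHom.comp_assoc, locMap_comp_algebraMap, toLoc_comp_algebraMap,
             RingHom.id_comp, toLoc_comp_algebraMap] }

/-- The cocone point of `ringCocone` (by `rfl`). [folklore] -/
theorem ringCocone_pt : (ringCocone S B).pt = CommRingCat.of B := rfl

/-- The legs of `ringCocone` (by `rfl`). [folklore] -/
theorem ringCocone_ι_app_hom (s : (Idx S)ᵒᵖ) :
    ((ringCocone S B).ι.app s).hom = toLoc S B s.unop := rfl

variable {S} in
/-- In a cocone over `ringDiagram`, all the composites `A → A[1/s] → pt` agree with the one for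
`s = 1`. [folklore] -/
theorem cocone_ι_comp_algebraMap (c : Cocone (ringDiagram S)) (s : (Idx S)ᵒᵖ) :
    (c.ι.app s).hom.comp (algebraMap A (loc S s.unop)) =
      (c.ι.app (op default)).hom.comp (algebraMap A (loc S default)) := by
  have hnat : (ringDiagram S).map ((homOfLE (Idx.le_default S s.unop)).op) ≫ c.ι.app s =
      c.ι.app (op default) := c.w _
  rw [← hnat, CommRingCat.hom_comp, RingHom.comp_assoc]
  exact congrArg _ (ringDiagram_map_comp_algebraMap _).symm

variable {S} in
/-- In a cocone over `ringDiagram`, every `s ∈ S` becomes a unit in the cocone point.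
[folklore] -/
theorem isUnit_cocone (c : Cocone (ringDiagram S)) (y : S) :
    IsUnit (((c.ι.app (op default)).hom.comp (algebraMap A (loc S default))) y) := by
  rw [← cocone_ι_comp_algebraMap c (op ⟨y.1, y.2⟩)]
  exact (IsLocalization.Away.algebraMap_isUnit (S := loc S ⟨y.1, y.2⟩) y.1).map
    (c.ι.app (op ⟨y.1, y.2⟩)).hom

/-- The ring map `B = A_S → pt` induced by a cocone over `ringDiagram`. [folklore] -/
def ringDesc (c : Cocone (ringDiagram S)) : B →+* c.pt :=
  IsLocalization.lift (M := S) (isUnit_cocone c)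

/-- `ringDesc` restricted to `A`. [folklore] -/
theorem ringDesc_comp_algebraMap (c : Cocone (ringDiagram S)) :
    (ringDesc S B c).comp (algebraMap A B) =
      (c.ι.app (op default)).hom.comp (algebraMap A (loc S default)) := by
  unfold ringDesc
  exact IsLocalization.lift_comp _

/-- **`B = A_S` is the filtered colimit of the `A[1/s]`, `s ∈ S`** (universal property of the
localization). [folklore] -/
def isColimitRingCocone : IsColimit (ringCocone S B) where
  desc c := CommRingCat.ofHom (ringDesc S B c)
  fac c s := by
    ext : 1
    refine IsLocalization.ringHom_ext (Submonoid.powers s.unop.val) (S := loc S s.unop) ?_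
    change ((ringDesc S B c).comp (toLoc S B s.unop)).comp (algebraMap A (loc S s.unop)) =
      (c.ι.app s).hom.comp (algebraMap A (loc S s.unop))
    rw [RingHom.comp_assoc, toLoc_comp_algebraMap, ringDesc_comp_algebraMap]
    exact (cocone_ι_comp_algebraMap c s).symm
  uniq c m hm := by
    ext : 1
    change (m.hom : B →+* c.pt) = ringDesc S B c
    refine IsLocalization.ringHom_ext S (S := B) (j := (m.hom : B →+* c.pt)) ?_
    rw [ringDesc_comp_algebraMap, ← hm (op default)]
    change _ = (m.hom.comp (toLoc S B default)).comp (algebraMap A (loc S default))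
    rw [RingHom.comp_assoc]
    exact (congrArg m.hom.comp (toLoc_comp_algebraMap S B default)).symm

/-- The structure maps `A → A[1/s]`, as a natural transformation. [folklore] -/
def baseNat : (Functor.const (Idx S)ᵒᵖ).obj (CommRingCat.of A) ⟶ ringDiagram S where
  app s := CommRingCat.ofHom (algebraMap A (loc S s.unop))
  naturality s t f := by
    ext : 1
    change (algebraMap A (loc S t.unop)).comp (RingHom.id A) =
      (locMap f.unop.le).comp (algebraMap A (loc S s.unop))
    rw [RingHom.comp_id, locMap_comp_algebraMap]

/-- The structure maps `A → A[1/s] → B` compose to `A → B`. [folklore] -/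
theorem baseNat_ι (s : (Idx S)ᵒᵖ) :
    (baseNat S).app s ≫ (ringCocone S B).ι.app s = CommRingCat.ofHom (algebraMap A B) := by
  ext : 1
  exact toLoc_comp_algebraMap S B s.unop

/-! ## `Spec B = lim Spec A[1/s]` over `Spec A` -/

/-- The cofiltered diagram of `A`-schemes `s ↦ Spec A[1/s]` (open subschemes `D(s)` of
`Spec A`). [folklore] -/
def baseDiagram : Idx S ⥤ SchemeOver A where
  obj s := specOver A (loc S s)
  map {t s} f := Over.homMk (Spec.map ((ringDiagram S).map f.op)) (by
    change Spec.map _ ≫ Spec.map ((baseNat S).app (op s)) = Spec.map ((baseNat S).app (op t))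
    rw [← Spec.map_comp]
    exact congrArg Spec.map (((baseNat S).naturality f.op).symm.trans (Category.id_comp _)))
  map_id s := by
    ext : 1
    change Spec.map ((ringDiagram S).map (𝟙 (op s))) = 𝟙 _
    rw [(ringDiagram S).map_id, Spec.map_id]
  map_comp {t s r} f g := by
    ext : 1
    change Spec.map ((ringDiagram S).map (g.op ≫ f.op)) = Spec.map _ ≫ Spec.map _
    rw [(ringDiagram S).map_comp, Spec.map_comp]

/-- The cone `Spec B → Spec A[1/s]` of `A`-schemes. [folklore] -/
def baseCone : Cone (baseDiagram S) where
  pt := specOver A B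
  π := { app s := Over.homMk (Spec.map ((ringCocone S B).ι.app (op s))) (by
            change Spec.map _ ≫ Spec.map ((baseNat S).app (op s)) =
              Spec.map (CommRingCat.ofHom (algebraMap A B))
            rw [← Spec.map_comp, baseNat_ι])
         naturality t s f := by
            ext : 1
            change 𝟙 _ ≫ Spec.map _ = Spec.map _ ≫ Spec.map ((ringDiagram S).map f.op)
            rw [Category.id_comp, ← Spec.map_comp]
            exact congrArg Spec.map ((ringCocone S B).w f.op).symm }

/-- The objects of `baseDiagram` (by `rfl`). [folklore] -/
theorem baseDiagram_obj (s : Idx S) : (baseDiagram S).obj s = specOver A (loc S s) := rfl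

/-- The transition maps of `baseDiagram` (by `rfl`). [folklore] -/
theorem baseDiagram_map_left {t s : Idx S} (f : t ⟶ s) :
    ((baseDiagram S).map f).left = Spec.map ((ringDiagram S).map f.op) := rfl

/-- The cone point of `baseCone` (by `rfl`). [folklore] -/
theorem baseCone_pt : (baseCone S B).pt = specOver A B := rfl

/-- The legs of `baseCone` (by `rfl`). [folklore] -/
theorem baseCone_π_app_left (s : Idx S) :
    ((baseCone S B).π.app s).left = Spec.map ((ringCocone S B).ι.app (op s)) := rfl

/-- The legs of `baseCone` are `Spec` of the maps `A[1/s] → B` (by `rfl`). [folklore] -/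
theorem baseCone_π_app_left' (s : Idx S) :
    ((baseCone S B).π.app s).left = Spec.map (CommRingCat.ofHom (toLoc S B s)) := rfl

/-- `Over.forget` maps `baseCone` to `Spec` of the ring cocone (by `rfl`). [folklore] -/
theorem forget_mapCone_baseCone :
    (Over.forget _).mapCone (baseCone S B) =
      Scheme.Spec.mapCone (coneRightOpOfCocone (ringCocone S B)) := rfl

/-- `Spec B` is the limit of the `Spec A[1/s]` in `Scheme`. [folklore] -/
def isLimitForgetBaseCone : IsLimit ((Over.forget _).mapCone (baseCone S B)) := by
  rw [forget_mapCone_baseCone]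
  exact isLimitOfPreserves Scheme.Spec (isLimitConeRightOpOfCocone _ (isColimitRingCocone S B))

/-- **`Spec A_S` is the limit of the open subschemes `Spec A[1/s]`, `s ∈ S`, in `A`-schemes.**
[folklore] -/
def isLimitBaseCone : IsLimit (baseCone S B) := by
  haveI : IsConnected (Idx S) := IsCofiltered.isConnected _
  exact isLimitOfReflects (Over.forget _) (isLimitForgetBaseCone S B)

/-- Two indices have a common refinement (the product). [folklore] -/
theorem exists_hom₂ (s t : Idx S) : ∃ r : Idx S, Nonempty (r ⟶ s) ∧ Nonempty (r ⟶ t) :=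
  ⟨⟨s.val * t.val, S.mul_mem s.mem t.mem⟩, ⟨homOfLE (dvd_mul_right _ _)⟩,
    ⟨homOfLE (dvd_mul_left _ _)⟩⟩

/-- The stages `Spec A[1/s]` are affine schemes. [folklore] -/
instance isAffine_baseDiagram_obj_left (s : Idx S) : IsAffine ((baseDiagram S).obj s).left :=
  inferInstanceAs (IsAffine (Spec (CommRingCat.of (loc S s))))

/-- `Spec B` is an affine scheme. [folklore] -/
instance isAffine_baseCone_pt_left : IsAffine (baseCone S B).pt.left :=
  inferInstanceAs (IsAffine (Spec (CommRingCat.of B)))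

/-- The stages `Spec A[1/s]` are quasi-compact. [folklore] -/
instance compactSpace_baseDiagram_obj_left (s : Idx S) :
    CompactSpace ((baseDiagram S).obj s).left :=
  inferInstanceAs (CompactSpace (Spec (CommRingCat.of (loc S s))))

/-- The stages `Spec A[1/s]` are quasi-separated. [folklore] -/
instance quasiSeparatedSpace_baseDiagram_obj_left (s : Idx S) :
    QuasiSeparatedSpace ((baseDiagram S).obj s).left :=
  inferInstanceAs (QuasiSeparatedSpace (Spec (CommRingCat.of (loc S s))))

/-- The transition maps `Spec A[1/t] → Spec A[1/s]` are affine. [folklore] -/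
instance isAffineHom_baseDiagram_map_left {t s : Idx S} (f : t ⟶ s) :
    IsAffineHom ((baseDiagram S).map f).left :=
  isAffineHom_of_isAffine _

/-- The stages `Spec A[1/s] → Spec A` are open immersions. [folklore] -/
instance isOpenImmersion_baseDiagram_obj_hom (s : Idx S) :
    IsOpenImmersion ((baseDiagram S).obj s).hom :=
  IsOpenImmersion.of_isLocalization (S := loc S s) s.val

/-- The transition maps `Spec A[1/t] → Spec A[1/s]` are open immersions (left cancellation).
[folklore] -/
instance isOpenImmersion_baseDiagram_map_left {t s : Idx S} (f : t ⟶ s) :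
    IsOpenImmersion ((baseDiagram S).map f).left :=
  haveI : IsOpenImmersion (((baseDiagram S).map f).left ≫ ((baseDiagram S).obj s).hom) := by
    rw [Over.w]; infer_instance
  IsOpenImmersion.of_comp _ ((baseDiagram S).obj s).hom

end LocApprox

end Literature.AlgebraicGeometry.Limits

end
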